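import Summits.QuantumFields.YangMills.Theorems.BalabanUVNodesK0RecordFormatNamesLemmas4
import Summits.QuantumFields.YangMills.Theorems.BalabanUVNodesK0RecordFormatNamesDecay
import Literature.MathematicalPhysics.QuantumFieldTheory.Balaban1983to89.BetaPertRigid

/-!
# K0⁷ record FORMAT⁺ names — lemma file 5: the implications among the DECAY-ONLY Π-receipts of names EDITION 12
# (`…K0RecordFormatNamesDecay`): holomorphic ⟹ box ⟹ runs; finite volume + (1.21) ⟹ limit; runs ⟹ the RUN |β| letter (also at stub 2′'s θ-witness)

Companion of the EDITION-12 leaf.  The proofs are lens seat `ymgap-nodeO-lens-1` g4's (HOME `nodeO-cover/LENS-1-PiDecayRuns-v1.lean` 3c15041c4b73908f ∕ v1.1,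
§0–§2b), re-homed over the tree names with credit; kernel-checked bookkeeping, nothing of Bałaban's asserted; DEFINER seat `ym-nodeO-def-1` gen 34;
`--kind proof --supports stmt-QuantumFields-20541 --as helper`.

* §0 boxes and runs: a run's prefix lies in the box of its interval level (the constant history's membership is `BetaPertRigid.const_mem_box`).
* §1 GENERIC: `PiHoloUniformOf ⟹ PlimDecayOnBoxOf` (SAME `(C, δ₁)`; only `decay` + `re_eq` at the history's own last coupling are read — the holomorphic receipt is
  STRONGER); `PlimDecayOnBoxOf ⟹ PlimDecayOnRunsOf β γ₀` for any driving `β` and level `γ₀ ≤ γ`; decay at a history ⟹ `|betaMerged| ≤ β′₅.₁₀ = betaPrime510 4 C δ₁`;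
  FINITE VOLUME ⟹ LIMIT (`tendsto_pvolOf` + `le_of_tendsto`) on the box and along runs.
* §2 RECORD (bare and Ax): `RecordPiHoloUniform[Ax] ⟹ RecordPlimDecayOnRuns[Ax]`; `RecordPolLimitOnRuns[Ax] ∧ RecordPvolDecayEvOnRuns[Ax] ⟹ RecordPlimDecayOnRuns[Ax]`;
  ★ `RecordPlimDecayOnRuns[Ax] ⟹` the RUN |β| letter `∀ n gs, RGEqH … → InInterval γ₀ … → ∀ k ≤ n, |β (k) (prefixOf gs k)| ≤ β′₅.₁₀` (`γ₀ ≤ ½`; ON THE BOX β IS the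
  (1.22)-moment of the limit kernel), also at stub 2′'s θ-witness by θ-blindness (`rfl`); the generic receipts instantiate to the record ones (`Iff.rfl`).

HONEST FRAMING.  Helper lemmas about DEF-1's names (count-neutral); no port text is closed here; T-3∕T-3′ UNSIGNED (Q-8 HOLD); stub 2′ OPEN; K0⁷ NOT closed (and as
vetted choice-centred); NODE O not inhabited; finite 𝕋⁴ at fixed ε — not continuum ∕ OS ∕ Clay; the Yang–Mills mass gap is NOT proved by any of this.
-/

noncomputable section

open scoped BigOperators Matrix.Norms.L2Operator Topology
open Set Filter

namespace Summit.QuantumFields.YangMills.Theorems.K0RecordFormatNames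

open Literature.MathematicalPhysics.QuantumFieldTheory.Balaban1983to89
open Literature.MathematicalPhysics.QuantumFieldTheory.Balaban1983to89.Node00
open Literature.MathematicalPhysics.QuantumFieldTheory.Balaban1983to89.T4Continuum (T4Family)
open Literature.MathematicalPhysics.QuantumFieldTheory.Balaban1983to89.FlowStep
open Literature.MathematicalPhysics.QuantumFieldTheory.Balaban1983to89.BetaPertRigid (const_mem_box)

/-! ## §0  Boxes and runs (the constant history's box membership is the tree's `BetaPertRigid.const_mem_box`) -/

/-- A run's prefix lies in the box of its interval level. [cite: Balaban1987RG1, Thm 1 p.259 (interval hypothesis; bookkeeping)] -/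
theorem prefixOf_mem_box_of_inInterval {γ₀ : ℝ} {n : ℕ} {gs : ℕ → ℝ} (hI : Step.InInterval γ₀ n gs) {k : ℕ} (hk : k ≤ n) :
    prefixOf gs k ∈ Box γ₀ k :=
  mem_box.2 fun i => hI i ((Nat.le_of_lt_succ i.2).trans hk)

variable (F : T4Family)

/-! ## §1  GENERIC implications -/

section Generic

variable {𝔄 : Type*} [NormedRing 𝔄] [NormedAlgebra ℝ 𝔄]
variable {V : Type*} [NormedAddCommGroup V] [NormedSpace ℝ V] {ι : Type*} [Fintype ι]
variable (fam : TermFamily1 F 𝔄) (ρ : V →L[ℝ] 𝔄) (bV : Module.Basis ι ℝ V)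

/-- **THE HOLOMORPHIC RECEIPT IS STRONGER**: `PiHoloUniformOf F fam ρ bV γ r C δ₁` (`γ > 0`) gives the decay-only box receipt with the SAME `(C, δ₁)` — only
`decay` + `re_eq` at the history's own last coupling are read (`decay510_pkOf_of_piHoloAtOf`, `pkOf_last`). [cite: Balaban1987RG1, (5.10) p.293, p.266 (analytic alternative; bookkeeping)] -/
theorem plimDecayOnBoxOf_of_piHoloUniformOf {γ r C δ₁ : ℝ} (hγ : 0 < γ) (h : PiHoloUniformOf F fam ρ bV γ r C δ₁) :
    PlimDecayOnBoxOf F fam ρ bV γ C δ₁ := by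
  refine ⟨(h.2 0 _ (const_mem_box hγ 0)).2.2.1, fun k v hv => ?_⟩
  have hlast : v (Fin.last k) ∈ Set.Icc (0 : ℝ) γ := ⟨(mem_box.1 hv (Fin.last k)).1.le, (mem_box.1 hv (Fin.last k)).2⟩
  have hd := decay510_pkOf_of_piHoloAtOf F fam ρ bV (h.2 k v hv) hlast
  rwa [pkOf_last] at hd

/-- **BOX ⟹ RUNS** (any driving `β`, any level `γ₀ ≤ γ`): a run's prefix is a box point. [cite: Balaban1987RG1, (0.20) p.256, Thm 1 p.259 (bookkeeping)] -/
theorem plimDecayOnRunsOf_of_plimDecayOnBoxOf {γ C δ₁ : ℝ} (h : PlimDecayOnBoxOf F fam ρ bV γ C δ₁) (β : HBeta) {γ₀ : ℝ} (hle : γ₀ ≤ γ) :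
    PlimDecayOnRunsOf F fam ρ bV β γ₀ C δ₁ :=
  ⟨h.1, fun _n _gs _ hI k hk => h.2 k _ (box_mono hle (prefixOf_mem_box_of_inInterval hI hk))⟩

/-- **DECAY AT A HISTORY BOUNDS THE MERGED β THERE**: `|betaMerged F fam ρ bV k v| ≤ β′₅.₁₀ = betaPrime510 4 C δ₁` (dominated second moment).
[cite: Balaban1987RG1, (1.22) p.264, (5.10) p.293, p.264 (Thm 3 «uniformly bounded»)] -/
theorem abs_betaMerged_le_of_decay510 {k : ℕ} {v : Fin (k + 1) → ℝ} {C δ₁ : ℝ} (hδ : 0 < δ₁)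
    (h : B12Sec2to5.Decay510 (plimOf F fam ρ bV k v 0 1) C δ₁) :
    |betaMerged F fam ρ bV k v| ≤ B12Sec2to5.betaPrime510 4 C δ₁ := by
  rw [betaMerged_eq_secondMoment_plimOf]
  exact (B12Sec2to5.secondMoment_abs_le_of_decay510 hδ h).2

/-- **(5.10) IS CLOSED UNDER THE VOLUME LIMIT**: pointwise-eventual finite-volume decay + the (1.21) letter at a history ⟹ decay of the limit kernel there.
[cite: Balaban1987RG1, (1.21) p.264, (5.10) p.293] -/
theorem decay510_plimOf_of_eventually {k : ℕ} {v : Fin (k + 1) → ℝ} {C δ₁ : ℝ}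
    (hlim : PolLimitExists F (k + 1) (fun K => fam k v K) ρ bV)
    (hK : ∀ z : Fin 4 → ℤ, ∀ᶠ K in atTop, |pvolOf F fam ρ bV k v K 0 1 z| ≤ C * Real.exp (-δ₁ * B12Sec2to5.l1 z)) :
    B12Sec2to5.Decay510 (plimOf F fam ρ bV k v 0 1) C δ₁ := fun z =>
  le_of_tendsto ((continuous_abs.tendsto _).comp (tendsto_pvolOf F fam ρ bV k v hlim 0 1 z)) (hK z)

/-- **FINITE VOLUME ⟹ LIMIT, ON THE BOX.** [cite: Balaban1987RG1, (1.21) p.264, (5.10) p.293] -/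
theorem plimDecayOnBoxOf_of_pvolDecayEvOnBoxOf {γ C δ₁ : ℝ} (hlim : PolLimitOnBoxOf F fam ρ bV γ) (h : PvolDecayEvOnBoxOf F fam ρ bV γ C δ₁) :
    PlimDecayOnBoxOf F fam ρ bV γ C δ₁ :=
  ⟨h.1, fun k v hv => decay510_plimOf_of_eventually F fam ρ bV (hlim k v hv) (h.2 k v hv)⟩

/-- **FINITE VOLUME ⟹ LIMIT, ALONG RUNS** — the join «T-3′-output ⟹ the decay-only run receipt». [cite: Balaban1987RG1, (1.21) p.264, (5.10) p.293, (0.20) p.256] -/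
theorem plimDecayOnRunsOf_of_pvolDecayEvOnRunsOf {β : HBeta} {γ₀ C δ₁ : ℝ} (hlim : PolLimitOnRunsOf F fam ρ bV β γ₀)
    (h : PvolDecayEvOnRunsOf F fam ρ bV β γ₀ C δ₁) : PlimDecayOnRunsOf F fam ρ bV β γ₀ C δ₁ :=
  ⟨h.1, fun n gs hrg hI k hk => decay510_plimOf_of_eventually F fam ρ bV (hlim n gs hrg hI k hk) (h.2 n gs hrg hI k hk)⟩

end Generic

/-! ## §2  RECORD implications (bare and Ax) -/

variable (a₀ ε₂₉ : ℝ)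

/-- The record run receipt IS the generic one at `(recordTerms F a₀ ε₂₉, θfill.ρ8, θfill.bV)` (`Iff.rfl`). [cite: Balaban1987RG1, (5.10) p.293 (bookkeeping)] -/
theorem recordPlimDecayOnRuns_iff (γ₀ C δ₁ : ℝ) :
    RecordPlimDecayOnRuns F a₀ ε₂₉ γ₀ C δ₁ ↔
      (letI θ := thetaFill F a₀ ε₂₉
       letI := θ.instVβ₁; letI := θ.instVβ₂; letI := θ.instιβ
       PlimDecayOnRunsOf F (recordTerms F a₀ ε₂₉) θ.ρ8 θ.bV (betaOfRecord₁₃ F 2 (thetaFill F a₀ ε₂₉)) γ₀ C δ₁) := Iff.rfl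

/-- … Ax (`Iff.rfl`). [cite: Balaban1987RG1, (5.10) p.293 (bookkeeping)] -/
theorem recordPlimDecayOnRunsAx_iff (γ₀ C δ₁ : ℝ) :
    RecordPlimDecayOnRunsAx F a₀ ε₂₉ γ₀ C δ₁ ↔
      (letI θ := thetaFill F a₀ ε₂₉
       letI := θ.instVβ₁; letI := θ.instVβ₂; letI := θ.instιβ
       PlimDecayOnRunsOf F (recordTermsAx F a₀ ε₂₉) θ.ρ8 θ.bV (betaOfRecord₁₃Ax F 2 (thetaFill F a₀ ε₂₉)) γ₀ C δ₁) := Iff.rfl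

/-- **THE HOLOMORPHIC RECORD RECEIPT ⟹ THE DECAY-ONLY RUN RECEIPT** (bare; level `0 < γ₀ ≤ γ`, same `(C, δ₁)`). [cite: Balaban1987RG1, (5.10) p.293, p.266 (analytic alternative; bookkeeping)] -/
theorem recordPlimDecayOnRuns_of_recordPiHoloUniform {γ r C δ₁ γ₀ : ℝ} (hγ₀ : 0 < γ₀) (hle : γ₀ ≤ γ)
    (h : RecordPiHoloUniform F a₀ ε₂₉ γ r C δ₁) : RecordPlimDecayOnRuns F a₀ ε₂₉ γ₀ C δ₁ := by
  refine ⟨(h.2 0 _ (const_mem_box (hγ₀.trans_le hle) 0)).2.2.1, fun n gs _ hI k hk => ?_⟩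
  have hv : prefixOf gs k ∈ Box γ k := box_mono hle (prefixOf_mem_box_of_inInterval hI hk)
  have hlast : prefixOf gs k (Fin.last k) ∈ Set.Icc (0 : ℝ) γ := ⟨(mem_box.1 hv (Fin.last k)).1.le, (mem_box.1 hv (Fin.last k)).2⟩
  have hd := decay510_recordPk_of_recordPiHoloAt F a₀ ε₂₉ (h.2 k _ hv) hlast
  rwa [recordPk_last] at hd

/-- **… Ax twin.** [cite: Balaban1987RG1, (5.10) p.293, p.266 (analytic alternative; bookkeeping)] -/
theorem recordPlimDecayOnRunsAx_of_recordPiHoloUniformAx {γ r C δ₁ γ₀ : ℝ} (hγ₀ : 0 < γ₀) (hle : γ₀ ≤ γ)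
    (h : RecordPiHoloUniformAx F a₀ ε₂₉ γ r C δ₁) : RecordPlimDecayOnRunsAx F a₀ ε₂₉ γ₀ C δ₁ := by
  refine ⟨(h.2 0 _ (const_mem_box (hγ₀.trans_le hle) 0)).2.2.1, fun n gs _ hI k hk => ?_⟩
  have hv : prefixOf gs k ∈ Box γ k := box_mono hle (prefixOf_mem_box_of_inInterval hI hk)
  have hlast : prefixOf gs k (Fin.last k) ∈ Set.Icc (0 : ℝ) γ := ⟨(mem_box.1 hv (Fin.last k)).1.le, (mem_box.1 hv (Fin.last k)).2⟩
  have hd := decay510_recordPkAx_of_recordPiHoloAtAx F a₀ ε₂₉ (h.2 k _ hv) hlast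
  letI θ := thetaFill F a₀ ε₂₉
  letI := θ.instVβ₁; letI := θ.instVβ₂; letI := θ.instιβ
  have hlastAx : recordPkAx F a₀ ε₂₉ k (prefixOf gs k) (prefixOf gs k (Fin.last k)) = recordPlimAx F a₀ ε₂₉ k (prefixOf gs k) := by
    show pkOf F (recordTermsAx F a₀ ε₂₉) θ.ρ8 θ.bV k (prefixOf gs k) (prefixOf gs k (Fin.last k)) = _
    rw [pkOf_last]
    rfl
  rwa [hlastAx] at hd

/-- **★ FINITE VOLUME ⟹ LIMIT AT THE RECORD, ALONG RUNS** (bare): `RecordPolLimitOnRuns ∧ RecordPvolDecayEvOnRuns ⟹ RecordPlimDecayOnRuns` (same `(C, δ₁)`;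
`tendsto_recordPvol` + `le_of_tendsto`). [cite: Balaban1987RG1, (1.21) p.264, (5.10) p.293, (0.20) p.256] -/
theorem recordPlimDecayOnRuns_of_pvol {γ₀ C δ₁ : ℝ} (hlim : RecordPolLimitOnRuns F a₀ ε₂₉ γ₀) (h : RecordPvolDecayEvOnRuns F a₀ ε₂₉ γ₀ C δ₁) :
    RecordPlimDecayOnRuns F a₀ ε₂₉ γ₀ C δ₁ :=
  ⟨h.1, fun n gs hrg hI k hk z =>
    le_of_tendsto ((continuous_abs.tendsto _).comp (tendsto_recordPvol F a₀ ε₂₉ k (prefixOf gs k) (hlim n gs hrg hI k hk) 0 1 z))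
      (h.2 n gs hrg hI k hk z)⟩

/-- **★ … Ax** (generic `tendsto_pvolOf` at `fam := recordTermsAx`). [cite: Balaban1987RG1, (1.21) p.264, (5.10) p.293, (0.20) p.256] -/
theorem recordPlimDecayOnRunsAx_of_pvol {γ₀ C δ₁ : ℝ} (hlim : RecordPolLimitOnRunsAx F a₀ ε₂₉ γ₀) (h : RecordPvolDecayEvOnRunsAx F a₀ ε₂₉ γ₀ C δ₁) :
    RecordPlimDecayOnRunsAx F a₀ ε₂₉ γ₀ C δ₁ := by
  refine ⟨h.1, fun n gs hrg hI k hk z => ?_⟩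
  letI θ := thetaFill F a₀ ε₂₉
  letI := θ.instVβ₁; letI := θ.instVβ₂; letI := θ.instιβ
  have ht : Tendsto (fun K => recordPvolAx F a₀ ε₂₉ k (prefixOf gs k) K 0 1 z) atTop
      (𝓝 (recordPlimAx F a₀ ε₂₉ k (prefixOf gs k) 0 1 z)) :=
    tendsto_pvolOf F (recordTermsAx F a₀ ε₂₉) θ.ρ8 θ.bV k (prefixOf gs k) (hlim n gs hrg hI k hk) 0 1 z
  exact le_of_tendsto ((continuous_abs.tendsto _).comp ht) (h.2 n gs hrg hI k hk z)

/-- **★ THE DECAY-ONLY RUN RECEIPT ⟹ THE RUN |β| LETTER** (bare, level `γ₀ ≤ ½`): along every in-interval solution of the record's own (0.20) up to `n`,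
`|β_{k+1}(g_0, …, g_k)| ≤ β′₅.₁₀ = betaPrime510 4 C δ₁` for `k ≤ n` (ON THE BOX β IS the (1.22)-moment of `recordPlim`; dominated second moment).
[cite: Balaban1987RG1, (1.22) p.264, (5.10) p.293, (5.42) p.297, p.264 (Thm 3 «uniformly bounded»)] -/
theorem runAbs_of_recordPlimDecayOnRuns {γ₀ C δ₁ : ℝ} (hγh : γ₀ ≤ 1 / 2) (h : RecordPlimDecayOnRuns F a₀ ε₂₉ γ₀ C δ₁) :
    ∀ (n : ℕ) (gs : ℕ → ℝ), RGEqH n (betaOfRecord₁₃ F 2 (thetaFill F a₀ ε₂₉)) gs → Step.InInterval γ₀ n gs →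
      ∀ k, k ≤ n → |betaOfRecord₁₃ F 2 (thetaFill F a₀ ε₂₉) k (prefixOf gs k)| ≤ B12Sec2to5.betaPrime510 4 C δ₁ := by
  intro n gs hrg hI k hk
  have hv : prefixOf gs k ∈ Box (1 / 2) k := box_mono hγh (prefixOf_mem_box_of_inInterval hI hk)
  rw [betaOfRecord₁₃_thetaFill_of_mem_box F a₀ ε₂₉ hv]
  exact (B12Sec2to5.secondMoment_abs_le_of_decay510 h.1 (h.2 n gs hrg hI k hk)).2

/-- **★ … Ax twin** (the RE-CENTRED β). [cite: Balaban1987RG1, (1.22) p.264, (5.10) p.293, (5.42) p.297] -/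
theorem runAbs_of_recordPlimDecayOnRunsAx {γ₀ C δ₁ : ℝ} (hγh : γ₀ ≤ 1 / 2) (h : RecordPlimDecayOnRunsAx F a₀ ε₂₉ γ₀ C δ₁) :
    ∀ (n : ℕ) (gs : ℕ → ℝ), RGEqH n (betaOfRecord₁₃Ax F 2 (thetaFill F a₀ ε₂₉)) gs → Step.InInterval γ₀ n gs →
      ∀ k, k ≤ n → |betaOfRecord₁₃Ax F 2 (thetaFill F a₀ ε₂₉) k (prefixOf gs k)| ≤ B12Sec2to5.betaPrime510 4 C δ₁ := by
  intro n gs hrg hI k hk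
  have hv : prefixOf gs k ∈ Box (1 / 2) k := box_mono hγh (prefixOf_mem_box_of_inInterval hI hk)
  rw [betaOfRecord₁₃Ax_thetaFill_of_mem_box F a₀ ε₂₉ hv]
  exact (B12Sec2to5.secondMoment_abs_le_of_decay510 h.1 (h.2 n gs hrg hI k hk)).2

/-- **★ … AT STUB 2′'s OWN θ-WITNESS** (θ-blindness, `rfl`): the same run letter with β read at `theta13OfThm1CCMWZB F 2 j ½ a₀ ε₀ ε₂₉ B₃ B₃' a₀ a₁ 0 0`
(runs AND bound). [cite: Balaban1987RG1, (1.20)–(1.22) p.264 (bookkeeping), (5.10) p.293] -/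
theorem runAbs_thm1Witness_of_recordPlimDecayOnRuns {γ₀ C δ₁ : ℝ} (hγh : γ₀ ≤ 1 / 2) (h : RecordPlimDecayOnRuns F a₀ ε₂₉ γ₀ C δ₁)
    (j : ℕ) (ε₀ B₃ B₃' a₁ : ℝ) :
    ∀ (n : ℕ) (gs : ℕ → ℝ),
      RGEqH n (betaOfRecord₁₃ F 2 (theta13OfThm1CCMWZB F 2 j (1 / 2) a₀ ε₀ ε₂₉ B₃ B₃' a₀ a₁ (fun _ _ => 0) (fun _ _ => 0))) gs →
      Step.InInterval γ₀ n gs → ∀ k, k ≤ n →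
        |betaOfRecord₁₃ F 2 (theta13OfThm1CCMWZB F 2 j (1 / 2) a₀ ε₀ ε₂₉ B₃ B₃' a₀ a₁ (fun _ _ => 0) (fun _ _ => 0)) k (prefixOf gs k)| ≤
          B12Sec2to5.betaPrime510 4 C δ₁ := by
  rw [betaOfRecord₁₃_thm1Witness_eq_thetaFill]
  exact runAbs_of_recordPlimDecayOnRuns F a₀ ε₂₉ hγh h

/-- **★ … Ax twin at the θ-witness.** [cite: Balaban1987RG1, (1.20)–(1.22) p.264 (bookkeeping), (5.10) p.293] -/
theorem runAbs_thm1Witness_of_recordPlimDecayOnRunsAx {γ₀ C δ₁ : ℝ} (hγh : γ₀ ≤ 1 / 2) (h : RecordPlimDecayOnRunsAx F a₀ ε₂₉ γ₀ C δ₁)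
    (j : ℕ) (ε₀ B₃ B₃' a₁ : ℝ) :
    ∀ (n : ℕ) (gs : ℕ → ℝ),
      RGEqH n (betaOfRecord₁₃Ax F 2 (theta13OfThm1CCMWZB F 2 j (1 / 2) a₀ ε₀ ε₂₉ B₃ B₃' a₀ a₁ (fun _ _ => 0) (fun _ _ => 0))) gs →
      Step.InInterval γ₀ n gs → ∀ k, k ≤ n →
        |betaOfRecord₁₃Ax F 2 (theta13OfThm1CCMWZB F 2 j (1 / 2) a₀ ε₀ ε₂₉ B₃ B₃' a₀ a₁ (fun _ _ => 0) (fun _ _ => 0)) k (prefixOf gs k)| ≤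
          B12Sec2to5.betaPrime510 4 C δ₁ := by
  rw [betaOfRecord₁₃Ax_thm1Witness_eq_thetaFill]
  exact runAbs_of_recordPlimDecayOnRunsAx F a₀ ε₂₉ hγh h

end Summit.QuantumFields.YangMills.Theorems.K0RecordFormatNames

end
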